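import Summits.AtomisticToContinuum.BoseEinsteinCondensation.Theses.BECPalmDirectCorrelation
import Literature.MathematicalPhysics.QuantumManyBody.CondensateOccupationStability
import Literature.MathematicalPhysics.QuantumManyBody.PeriodicClusteringFromKyFanGap

/-!
# Birth skeleton for crux `PalmChiSqCondensation` (stmt-AtomisticToContinuum-12226)

Route `BECPalmDirectCorrelation` (rank-4 crux; sub-problem `BoseEinsteinCondensation`); registrar
skeleton `Lines/birth.lean` (planner-skel-stmt-AtomisticToContinuum-12226-0, 2026-08-17).

**The crux (fixed, by name).** For every repulsive finite-range `v`: IF the liminf χ² bound holds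
(`∃ρ₀ ∀ρ<ρ₀ ∃C ∀ᶠn ∀δ>0 ∃` a `δ`-near-minimiser `Ψ` of the periodic `(n+1)`-body problem at side
`L = ((n+1)/ρ)^{1/3}` with Palm χ² functional `periodicMeanSelfDensity n L Ψ ≤ C`) THEN the
PeriodicBEC body holds for `v` (`∃ρ₀ ∀ρ<ρ₀ ∃c>0 ∀ᶠN ∃δ>0`, every `δ`-near-minimiser has
`condensateOccupation ≥ cN`).

**The line (three stubs, glued by two tree lemmas).** At fixed `(N, L)` the transfer
"liminf χ² bound ⇒ condensation of ALL near-minimisers" is the tree's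
`le_condensateOccupation_nearMinimiser_of_clustering` (CondensateOccupationStability.lean), whose two
inputs are (hcl) CLUSTERING of near-minimisers modulo a phase and (hocc) a CONDENSED near-minimiser
at every slack. The tree reduces (hcl) to a Ky Fan gap for every measurable `v`, hard cores included
(`exists_phase_integral_norm_sub_sq_le_of_kyFanGap`, PeriodicClusteringFromKyFanGap.lean). Hence:

* `stub_diluteKyFanGap` (size L; THE crux's declared risk): for repulsive finite-range `v`, at all
  small densities and eventually in `N`, the periodic ground-state energy at side `(N/ρ)^{1/3}` is
  FINITE and the ground state is variationally SIMPLE, `2E₀ < kyFanTwo`. Bounded `v`: in tree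
  (`PeriodicGroundStateNondegenerate_holds`, Feynman–Kac / Perron–Frobenius, ReedSimonIV §XIII.12)
  plus finiteness from the constant state; hard cores / `⊤`-shells: connectedness of the dilute
  hard-sphere torus configuration space + Faris–Simon, and finite-energy symmetrised lattice states
  at `ρ < (4R₀)⁻³` — not in print in this form (grounder g27-0 / refuter rreview: "the item's real
  residual lemma").
* `stub_diamagneticSmoothing` (size M–L): every periodic trial state `Ψ` has, for every `ε > 0`, a
  NONNEGATIVE trial state `Ψ'` with energy `≤ E(Ψ) + ε` and Palm functional `≤ F(Ψ) + ε`
  (`Ψ' ∝ |Ψ|²/√(|Ψ|² + t²)`, `t → 0`: `C¹`, periodic, symmetric, vanishes where `Ψ` does so hard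
  cores are respected; diamagnetic inequality `|∇|Ψ|| ≤ |∇Ψ|` + dominated convergence for the
  kinetic term, monotonicity for the interaction, dominated convergence for `F`, which is finite and
  modulus-invariant on continuous states).
* `stub_torusDeletionBound` (size M; the criterion constant `n₀ ≥ N/F`): for a NONNEGATIVE periodic
  trial state, `N ≤ n₀(Ψ) · F(Ψ)` in `ℝ≥0∞` (Hölder `b ≤ a^{2/3}s^{1/3}` in the deleted particle,
  Cauchy–Schwarz in the bath; torus twin of the retired Dirichlet item stmt-4370; explicitly left to
  provers by MeanSelfDensity.lean).

`PalmChiSqCondensation_of : Sig.stub_diluteKyFanGap → Sig.stub_diamagneticSmoothing →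
Sig.stub_torusDeletionBound → PalmChiSqCondensation` is sorry-free: `ρ₀' = min ρ₀ ρ₁`; at fixed
large `N = n+1` the χ² witness at slack `δ/2` is smoothed at slack `min(δ/2, 1)` into a nonnegative
`δ`-near-minimiser with `F ≤ C₁ + 1` (`C₁ = max C 1`), the deletion bound makes it condensed with
`c₀ = 1/(C₁ + 1)`, the Ky Fan gap gives clustering, and the tree transfer lemma gives
`n₀ ≥ (c₀/2)·N` on all near-minimisers at some slack; `c = c₀/2` is uniform in `N`.
Disproof.lean: none filed for this crux (ledger crux ls, 2026-08-17); negatives index: no statement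
of the summit concerns `periodicMeanSelfDensity`/`kyFanTwo` (20 entries checked).
-/

noncomputable section

open MeasureTheory Filter
open scoped ENNReal

namespace Summit.AtomisticToContinuum.BoseEinsteinCondensation.Cruxes.PalmChiSqCondensation.Birth

open Literature.MathematicalPhysics.QuantumManyBody.BoseGas
open Summit.AtomisticToContinuum.BoseEinsteinCondensation.Theses.BECPalmDirectCorrelation

/-! ## The stubs (statements `Sig.stub_<name> : Prop`; obligations `theorem stub_<name>`) -/

/-- **Stub 1 — dilute Ky Fan gap (finiteness + variational simplicity of the periodic ground state,
eventually in `N` at small density).** For a repulsive finite-range `v` there is `ρ₁ > 0` such that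
for `0 < ρ < ρ₁` and all large `N`, on the torus of side `L = (N/ρ)^{1/3}`:
`E₀ = periodicGroundStateEnergy v N L < ∞` and `2E₀ < kyFanTwo v N L` (the two lowest levels of
the form differ: the ground state of the closed form on the symmetric periodic `C¹` core is simple).
Why plausibly true: Perron–Frobenius / Faris–Simon for `-Δ + W` on the connected torus (bounded `v`:
tree theorem `PeriodicGroundStateNondegenerate_holds`); hard cores at low density: the admissible
hard-sphere configuration space of the torus is connected and carries finite-energy symmetric `C¹`
states; `⊤`-shells: bound sectors cost `≳ R₀⁻²` more than the unbound one for `ρ` small. Why it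
might fail: a degenerate periodic ground space for an exotic admissible `v` (the crux's own risk).
[ReedSimonIV1978 §XIII.12 Thms XIII.43–48; FarisSimon1975; LSSY2005 Thm 2.2] -/
def Sig.stub_diluteKyFanGap : Prop :=
  ∀ v : ℝ → ℝ≥0∞, IsRepulsiveFiniteRange v → ∃ ρ₁ : ℝ, 0 < ρ₁ ∧ ∀ ρ : ℝ, 0 < ρ → ρ < ρ₁ →
    ∀ᶠ N : ℕ in Filter.atTop,
      periodicGroundStateEnergy v N (sideLength ρ N) ≠ ⊤ ∧
        2 * periodicGroundStateEnergy v N (sideLength ρ N) < kyFanTwo v N (sideLength ρ N)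

/-- **Stub 2 — diamagnetic smoothing (nonnegative `C¹` replacement at arbitrarily small cost in
energy and in the Palm functional).** For measurable `v`, every periodic trial state `Ψ` of `n+1`
bosons and every `ε > 0` admit a periodic trial state `Ψ'` with `Ψ' ≥ 0` pointwise
(`Ψ' X = ‖Ψ' X‖`), `periodicEnergy v Ψ' ≤ periodicEnergy v Ψ + ε` and
`periodicMeanSelfDensity n L Ψ' ≤ periodicMeanSelfDensity n L Ψ + ε`. Candidate:
`Ψ'ₜ = fₜ(|Ψ|²)/‖fₜ(|Ψ|²)‖₂`, `fₜ(s) = s/√(s + t²)` (smooth on `s > -t²`, so `Ψ'ₜ ∈ C¹`; vanishes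
exactly where `Ψ` does, so `⊤ · 0 = 0` on hard cores; `fₜ(s)² ≤ s`): kinetic term by
`|∇|Ψ|| ≤ |∇Ψ|` and dominated convergence (`|∇Ψ'ₜ| ≤ (3/2√2)|∇Ψ|`), interaction monotone, `F` by
dominated convergence (`F < ∞` and slice ratios `≤ sup|Ψ|²` for continuous `Ψ`). [LSSY2005 §1.2;
folklore (diamagnetic inequality, ReedSimonIV1978 §XIII.12)] -/
def Sig.stub_diamagneticSmoothing : Prop :=
  ∀ (n : ℕ) (L : ℝ) (v : ℝ → ℝ≥0∞), Measurable v → ∀ Ψ : PeriodicTrialState (n + 1) L,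
    ∀ ε : ℝ≥0∞, 0 < ε → ∃ Ψ' : PeriodicTrialState (n + 1) L,
      (∀ X, Ψ'.ψ X = ((‖Ψ'.ψ X‖ : ℝ) : ℂ)) ∧
      periodicEnergy v Ψ' ≤ periodicEnergy v Ψ + ε ∧
      periodicMeanSelfDensity n L Ψ'.ψ ≤ periodicMeanSelfDensity n L Ψ.ψ + ε

/-- **Stub 3 — torus deletion bound (`N ≤ n₀ · F` for nonnegative states).** For `L > 0` and a
periodic trial state `Ψ ≥ 0` of `N = n+1` bosons, `N ≤ condensateOccupation N L Ψ ·
periodicMeanSelfDensity n L Ψ`: with `a(Y) = ∫_cell Ψ(·,Y)`, `b = ∫_cell Ψ²`, `s = ∫_cell Ψ⁴`,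
Hölder gives `b³ ≤ a²s`, hence `1 = ∫ b dY ≤ ∫ a √(s/b) ≤ (∫a²)^{1/2}(∫s/b)^{1/2}` and
`n₀ · F = N (L⁻³∫a²)(L³∫s/b) ≥ N`. False for signed/complex `Ψ` (`a` may vanish), whence Stub 2.
[PenroseOnsager1956; HolroydSoo2013 Thms 1.1–1.2 (deletion tolerance); LSSY2005 §1.2 (1.17)] -/
def Sig.stub_torusDeletionBound : Prop :=
  ∀ (n : ℕ) (L : ℝ), 0 < L → ∀ Ψ : PeriodicTrialState (n + 1) L,
    (∀ X, Ψ.ψ X = ((‖Ψ.ψ X‖ : ℝ) : ℂ)) →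
      ((n + 1 : ℕ) : ℝ≥0∞) ≤ condensateOccupation (n + 1) L Ψ.ψ * periodicMeanSelfDensity n L Ψ.ψ

/-- Registered stub 1 (dilute Ky Fan gap — the hardest). -/
theorem stub_diluteKyFanGap : Sig.stub_diluteKyFanGap := by
  sorry

/-- Registered stub 2 (diamagnetic smoothing). -/
theorem stub_diamagneticSmoothing : Sig.stub_diamagneticSmoothing := by
  sorry

/-- Registered stub 3 (torus deletion bound). -/
theorem stub_torusDeletionBound : Sig.stub_torusDeletionBound := by
  sorry

/-! ## Composition (sorry-free) -/

/-- `ofReal (x⁻¹ · N) = N / ofReal x` for `x > 0`. -/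
theorem ofReal_inv_mul_natCast {x : ℝ} (hx : 0 < x) (N : ℕ) :
    ENNReal.ofReal (x⁻¹ * N) = (N : ℝ≥0∞) / ENNReal.ofReal x := by
  rw [ENNReal.ofReal_mul (inv_nonneg.2 hx.le), ENNReal.ofReal_natCast, ENNReal.ofReal_inv_of_pos hx,
    mul_comm, div_eq_mul_inv]

/-- A Ky Fan gap in strict form yields a positive real gap `γ` in the additive form used by
`exists_phase_integral_norm_sub_sq_le_of_kyFanGap`. -/
theorem exists_real_gap {E K : ℝ≥0∞} (hE : E ≠ ⊤) (hlt : 2 * E < K) :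
    ∃ γ : ℝ, 0 < γ ∧ 2 * E + ENNReal.ofReal γ ≤ K := by
  rcases eq_or_ne K ⊤ with hK | hK
  · exact ⟨1, one_pos, by rw [hK]; exact le_top⟩
  · have h2E : 2 * E ≠ ⊤ := ENNReal.mul_ne_top (by norm_num) hE
    refine ⟨(K - 2 * E).toReal, ?_, ?_⟩
    · exact ENNReal.toReal_pos (tsub_pos_iff_lt.2 hlt).ne' (ENNReal.sub_ne_top hK)
    · rw [ENNReal.ofReal_toReal (ENNReal.sub_ne_top hK), add_tsub_cancel_of_le hlt.le]

/-- **The line concludes the crux BY NAME.** `ρ₀' = min ρ₀ ρ₁`; at fixed large `N = n+1`: smooth the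
χ² witness (Stub 2), condense it by the deletion bound (Stub 3, `c₀ = 1/(max C 1 + 1)`), cluster all
near-minimisers by the Ky Fan gap (Stub 1 + `exists_phase_integral_norm_sub_sq_le_of_kyFanGap`) and
transfer (`le_condensateOccupation_nearMinimiser_of_clustering`, `ε = c₀/2`). -/
theorem PalmChiSqCondensation_of :
    Sig.stub_diluteKyFanGap → Sig.stub_diamagneticSmoothing → Sig.stub_torusDeletionBound →
      PalmChiSqCondensation := by
  intro hGap hSmooth hDel v hv hhyp
  obtain ⟨ρ₀, hρ₀, H⟩ := hhyp
  obtain ⟨ρ₁, hρ₁, hG⟩ := hGap v hv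
  refine ⟨min ρ₀ ρ₁, lt_min hρ₀ hρ₁, fun ρ hρ hρlt => ?_⟩
  obtain ⟨C, hC⟩ := H ρ hρ (hρlt.trans_le (min_le_left _ _))
  have hGρ := hG ρ hρ (hρlt.trans_le (min_le_right _ _))
  -- constants, uniform in `N`
  set C₁ : ℝ := max C 1 with hC₁
  have hC₁pos : 0 < C₁ + 1 := by positivity
  set c₀ : ℝ := (C₁ + 1)⁻¹ with hc₀
  have hc₀pos : 0 < c₀ := inv_pos.2 hC₁pos
  refine ⟨c₀ - c₀ / 2, by linarith, ?_⟩
  -- eventually in `N`: both inputs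
  obtain ⟨a, ha⟩ := Filter.eventually_atTop.1 hC
  obtain ⟨b, hb⟩ := Filter.eventually_atTop.1 hGρ
  refine Filter.eventually_atTop.2 ⟨max (a + 1) b, fun N hN => ?_⟩
  obtain ⟨n, rfl⟩ : ∃ n, N = n + 1 := ⟨N - 1, by omega⟩
  have han : ∀ δ : ℝ≥0∞, 0 < δ → ∃ Ψ : PeriodicTrialState (n + 1) (sideLength ρ (n + 1)),
      periodicEnergy v Ψ ≤ periodicGroundStateEnergy v (n + 1) (sideLength ρ (n + 1)) + δ ∧
        periodicMeanSelfDensity n (sideLength ρ (n + 1)) Ψ.ψ ≤ ENNReal.ofReal C :=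
    ha n (by omega)
  obtain ⟨hEtop, hlt⟩ := hb (n + 1) (le_of_max_le_right hN)
  set L : ℝ := sideLength ρ (n + 1) with hLdef
  have hL : 0 < L := Real.rpow_pos_of_pos (div_pos (by exact_mod_cast Nat.succ_pos n) hρ) _
  -- (hcl) clustering of near-minimisers from the Ky Fan gap (tree)
  obtain ⟨γ, hγ, hgapγ⟩ := exists_real_gap hEtop hlt
  have hcl : ∀ η : ℝ, 0 < η → ∃ δ : ℝ≥0∞, 0 < δ ∧ ∀ Φ Φ' : PeriodicTrialState (n + 1) L,
      periodicEnergy v Φ ≤ periodicGroundStateEnergy v (n + 1) L + δ →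
      periodicEnergy v Φ' ≤ periodicGroundStateEnergy v (n + 1) L + δ →
      ∃ θ : ℝ, ∫ X in cellN (n + 1) L, ‖Φ.ψ X - Complex.exp (θ * Complex.I) * Φ'.ψ X‖ ^ 2 ≤ η :=
    fun η hη => exists_phase_integral_norm_sub_sq_le_of_kyFanGap hv.1 hγ hEtop hgapγ hη
  -- (hocc) a condensed near-minimiser at every slack: smoothing + deletion bound
  have hocc : ∀ δ : ℝ≥0∞, 0 < δ → ∃ Ψ : PeriodicTrialState (n + 1) L,
      periodicEnergy v Ψ ≤ periodicGroundStateEnergy v (n + 1) L + δ ∧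
        ENNReal.ofReal (c₀ * (n + 1 : ℕ)) ≤ condensateOccupation (n + 1) L Ψ.ψ := by
    intro δ hδ
    have hδ2 : 0 < δ / 2 := ENNReal.half_pos hδ.ne'
    obtain ⟨Ψ, hΨE, hΨF⟩ := han (δ / 2) hδ2
    obtain ⟨Ψ', hpos, hE', hF'⟩ :=
      hSmooth n L v hv.1 Ψ (min (δ / 2) 1) (lt_min hδ2 one_pos)
    refine ⟨Ψ', ?_, ?_⟩
    · calc periodicEnergy v Ψ' ≤ periodicEnergy v Ψ + min (δ / 2) 1 := hE'
        _ ≤ periodicGroundStateEnergy v (n + 1) L + δ / 2 + δ / 2 :=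
            add_le_add hΨE (min_le_left _ _)
        _ = periodicGroundStateEnergy v (n + 1) L + δ := by rw [add_assoc, ENNReal.add_halves]
    · have hF'' : periodicMeanSelfDensity n L Ψ'.ψ ≤ ENNReal.ofReal (C₁ + 1) := by
        calc periodicMeanSelfDensity n L Ψ'.ψ ≤ periodicMeanSelfDensity n L Ψ.ψ + min (δ / 2) 1 := hF'
          _ ≤ ENNReal.ofReal C + 1 := add_le_add hΨF (min_le_right _ _)
          _ ≤ ENNReal.ofReal C₁ + ENNReal.ofReal 1 := by
              rw [ENNReal.ofReal_one]
              exact add_le_add (ENNReal.ofReal_le_ofReal (le_max_left _ _)) le_rfl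
          _ = ENNReal.ofReal (C₁ + 1) := by
              rw [← ENNReal.ofReal_add (by positivity) zero_le_one]
      have h1 : ((n + 1 : ℕ) : ℝ≥0∞) ≤
          condensateOccupation (n + 1) L Ψ'.ψ * ENNReal.ofReal (C₁ + 1) :=
        calc ((n + 1 : ℕ) : ℝ≥0∞)
            ≤ condensateOccupation (n + 1) L Ψ'.ψ * periodicMeanSelfDensity n L Ψ'.ψ :=
              hDel n L hL Ψ' hpos
          _ ≤ condensateOccupation (n + 1) L Ψ'.ψ * ENNReal.ofReal (C₁ + 1) := by gcongr
      rw [hc₀, ofReal_inv_mul_natCast hC₁pos]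
      exact ENNReal.div_le_of_le_mul h1
  -- transfer to all near-minimisers (tree)
  exact le_condensateOccupation_nearMinimiser_of_clustering hL v hcl hocc (ε := c₀ / 2) (by positivity)

/-- The crux modulo the three registered stubs (becomes a closing proof when they land). -/
theorem palmChiSqCondensation_skeleton : PalmChiSqCondensation :=
  PalmChiSqCondensation_of stub_diluteKyFanGap stub_diamagneticSmoothing stub_torusDeletionBound

end Summit.AtomisticToContinuum.BoseEinsteinCondensation.Cruxes.PalmChiSqCondensation.Birth

end
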